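import Mathlib

/-!
# Exact downfolding identities: cRPA screening composition and Löwdin partitioning

Two pieces of EXACT algebra on which the "material ↦ effective model" (downfolding) pipeline
for correlated-electron materials rests.  Everything here is a proved theorem; there are no named
facts and no approximations — the physics approximations (RPA bubbles, a static `ω = 0` limit,
the choice of the retained subspace) live upstream of these identities, not in them.

## 1. cRPA screening composition (Aryasetiawan–Imada–Georges–Kotliar–Biermann–Lichtenstein 2004)

In the constrained random-phase approximation the polarization is split as `P = P_d + P_r`
(`P_d` = transitions inside the retained low-energy subspace, `P_r` = the rest); the fully
screened interaction is `W = (1 - v P)⁻¹ v` and the PARTIALLY screened ("Hubbard") interaction is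
`W_r = (1 - v P_r)⁻¹ v` [AryasetiawanEtAl2004, §II]; [WernerEtAl2015, §II.B Eq. (1)].  The identity
`W = (1 - W_r P_d)⁻¹ W_r` [AryasetiawanEtAl2004, §II, the displayed chain ending in
`[1 - W_r P_d]⁻¹ W_r`] says that screening `W_r` further by the retained-subspace polarization
`P_d` recovers `W` — the justification for using `U(ω) = W_r(ω)` as the model interaction.  We prove
it in an arbitrary (noncommutative) ring, with the two invertibility hypotheses the printed
derivation uses implicitly (`1 - vP_r` and `1 - vP` invertible), and DERIVE (not assume) the
invertibility of `1 - W_r P_d`: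

* `screen v P := Ring.inverse (1 - v * P) * v` — RPA-type screening of `v` by a polarization `P`;
* `one_sub_screen_mul` — `(1 - vP_r)` invertible ⇒ `1 - (screen v P_r) P_d = (1 - vP_r)⁻¹ (1 - v(P_d + P_r))`;
* `isUnit_one_sub_screen_mul` — hence `1 - W_r P_d` is invertible;
* `screen_screen` — **composition**: `screen (screen v P_r) P_d = screen v (P_d + P_r)`, i.e.
  `(1 - W_r P_d)⁻¹ W_r = W`;
* `matrix_screen_screen` — the same for square matrices with Mathlib's nonsingular inverse `⁻¹`
  and `IsUnit det` hypotheses (the finite-basis form in which codes evaluate it).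

## 2. Löwdin partitioning (energy-dependent downfolding of a block Hamiltonian)

For a block matrix `H = fromBlocks A B C D` and an energy `ω` with `ω - D` invertible, the
eigen-equation `H (x ⊕ y) = ω (x ⊕ y)` is EQUIVALENT to `y = (ω - D)⁻¹ C x` together with the
downfolded equation `(A + B (ω - D)⁻¹ C) x = ω x` on the retained block (Löwdin 1951 partitioning
technique; Feshbach / Bloch–Horowitz projection; cited from the block-matrix presentation
[BognerKuoSchwenk2003, §2.1 Eqs. (21)–(24)], read in the reprint in Brown–Kuo–Holt–Lee (eds.),
World Scientific 2010) — `loewdinHam`, `fromBlocks_mulVec_eq_smul_iff`, and the corollaries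
`loewdinHam_mulVec_of_eigen` / `eigen_of_loewdinHam_mulVec`.  This is the exact one-particle
statement behind "integrating out" the oxygen / axial orbitals at energy `ω` in the cuprate
four-orbital → one-orbital reductions [PavariniEtAl2001, Eqs. (2)–(3)]; the ENERGY DEPENDENCE of
`loewdinHam` is explicit, so any energy-independent `t, t′, t″` obtained from it is an expansion
(Pavarini et al. expand in the range parameter `r`), not an identity.  We also record
`loewdinHam_sub_smul_one`: `loewdinHam A B C D ω - ω•1 = (A - ω•1) - B (D - ω•1)⁻¹ C`, the Schur
complement of the block `D - ω•1` in `fromBlocks A B C D - ω•1` (cf.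
`Literature.LinearAlgebra.Matrix.schurCompl`, which pivots on the leading block; not imported, to
keep this file's dependencies to Mathlib).

## 3. The scalar (single-band) screening map (model-mapped RPA, Sakakibara et al. 2017)

For a one-band model the RPA map is the scalar `U ↦ U/(1 − U P)` (`P ≤ 0`); §3 records its closed
inversion `U = W/(1 + P W)` (the «model-mapped RPA» matching condition `W_M(U_M) = W_FP`,
[SakakibaraEtAl2016, Eqs. (8)–(9)]), strict monotonicity, the saturation bound `W < −1/P`, and the
derivative `(1 − U P)⁻²` behind the printed sensitivity remark (appended 2026-08-27, seat lit-1).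

## 4. The resolvent form of Löwdin partitioning (Profe et al. 2025, §III A)

`[(z − H)⁻¹]_{target} = (z − H_eff(z))⁻¹` and `det (z − H) = det (z − D) · det (z − H_eff(z))` for a
block one-body matrix and `z` off the spectrum of the rest block — the exact statement that
integrating out a NON-INTERACTING, kinetically coupled rest space adds the retarded hybridization
`B (z − D)⁻¹ C` to the target block and reproduces the target-space spectral function exactly
[ProfeEtAl2025ExactDownfolding, §III A Eqs. (21)–(25)] (appended 2026-08-30, seat lit-2; Mathlib's
Schur-complement algebra read through `loewdinHam`).

Every declaration carries its printed source; the one private plumbing lemma is `[folklore]`.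
Not here: anything approximate (RPA itself, frequency dependence, Wannier constructions),
positivity/monotonicity of screening, or operator (infinite-dimensional) versions.

References: F. Aryasetiawan, M. Imada, A. Georges, G. Kotliar, S. Biermann, A. I. Lichtenstein,
*Frequency-dependent local interactions and low-energy effective models from electronic structure
calculations*, Phys. Rev. B 70 (2004) 195104, arXiv:cond-mat/0401620, §II · P. Werner, R. Sakuma,
F. Nilsson, F. Aryasetiawan, *Dynamical screening in La₂CuO₄*, Phys. Rev. B 91 (2015) 125142,
§II.B · S. K. Bogner, T. T. S. Kuo, A. Schwenk, *Model-independent low momentum nucleon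
interaction from phase shift equivalence*, Phys. Rept. 386 (2003) 1, §2.1 · P.-O. Löwdin, *A note on
the quantum-mechanical perturbation theory*, J. Chem. Phys. 19 (1951) 1396 · E. Pavarini, I. Dasgupta, T. Saha-Dasgupta, O. Jepsen, O. K. Andersen, Phys. Rev.
Lett. 87 (2001) 047003, Eqs. (1)–(3) · H. Sakakibara, S. W. Jang, H. Kino, M. J. Han, K. Kuroki,
T. Kotani, *Model-mapped RPA for determining the effective Coulomb interaction*, J. Phys. Soc.
Jpn. 86 (2017) 044714, arXiv:1607.08336, Eqs. (8)–(9), §IV · J. B. Profe, J. Vučičević,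
P. P. Stavropoulos, M. Rösner, R. Valentí, L. Klebl, *Exact downfolding and its perturbative
approximation*, Phys. Rev. B (2025), doi:10.1103/npv1-w4gt, arXiv:2507.16916 (v4, 9 Mar 2026), §III A
Eqs. (21)–(25), §IV B.
AI-produced formalisation (H21, cell hubbard-downfold, seat lit-1, 2026-08-26); no facts, no axioms
beyond Mathlib's, no `sorry`.
-/

namespace Literature.MathematicalPhysics.QuantumLattice

/-! ## 1. cRPA screening composition in a ring -/

section Screening

variable {R : Type*} [Ring R]

/-- RPA-type screening of a (bare or partially screened) interaction `v` by a polarization `P`: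
`screen v P = (1 - v P)⁻¹ v`, with `Ring.inverse` (so the expression is defined everywhere and
equals the honest inverse whenever `1 - v P` is a unit).  With `P = P_r` this is the cRPA
partially screened interaction `W_r = U`, with the full `P` it is the fully screened `W`.
[cite: AryasetiawanEtAl2004, §II] -/
noncomputable def screen (v P : R) : R :=
  Ring.inverse (1 - v * P) * v

/-- [cite: AryasetiawanEtAl2004, §II] Unfolding lemma for `screen`. -/
theorem screen_def (v P : R) : screen v P = Ring.inverse (1 - v * P) * v := rfl

/-- [cite: AryasetiawanEtAl2004, §II] Screening by the zero polarization does nothing: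
`screen v 0 = v`. -/
theorem screen_zero (v : R) : screen v 0 = v := by
  simp [screen]

/-- [cite: AryasetiawanEtAl2004, §II] The algebraic heart of the cRPA identity: if `1 - v P_r`
is invertible then `1 - W_r P_d = (1 - v P_r)⁻¹ (1 - v (P_d + P_r))` with `W_r = screen v P_r`
(the factorisation step of the displayed derivation in the source). -/
theorem one_sub_screen_mul (v Pd Pr : R) (hr : IsUnit (1 - v * Pr)) :
    1 - screen v Pr * Pd = Ring.inverse (1 - v * Pr) * (1 - v * (Pd + Pr)) := by
  have hsplit : (1 : R) - v * (Pd + Pr) = (1 - v * Pr) - v * Pd := by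
    rw [mul_add]; abel
  rw [hsplit, mul_sub, Ring.inverse_mul_cancel _ hr, screen, mul_assoc]

/-- [cite: AryasetiawanEtAl2004, §II] In cRPA the element `1 - W_r P_d` IS invertible as soon
as `1 - v P_r` and `1 - v P` (`P = P_d + P_r`) are — this is used silently when the source
writes `[1 - W_r P_d]⁻¹`. -/
theorem isUnit_one_sub_screen_mul (v Pd Pr : R) (hr : IsUnit (1 - v * Pr))
    (h : IsUnit (1 - v * (Pd + Pr))) : IsUnit (1 - screen v Pr * Pd) := by
  rw [one_sub_screen_mul v Pd Pr hr]
  exact (hr.ringInverse).mul h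

/-- **cRPA screening composition** [cite: AryasetiawanEtAl2004, §II]: screening the partially
screened interaction `W_r = (1 - vP_r)⁻¹ v` further by the retained-subspace polarization `P_d`
gives the fully screened interaction, `(1 - W_r P_d)⁻¹ W_r = (1 - v(P_d + P_r))⁻¹ v = W`, in
any ring, provided `1 - vP_r` and `1 - v(P_d + P_r)` are invertible. -/
theorem screen_screen (v Pd Pr : R) (hr : IsUnit (1 - v * Pr))
    (h : IsUnit (1 - v * (Pd + Pr))) :
    screen (screen v Pr) Pd = screen v (Pd + Pr) := by
  rw [screen_def (screen v Pr), screen_def v (Pd + Pr),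
    Ring.inverse_mul_eq_iff_eq_mul _ _ _ (isUnit_one_sub_screen_mul v Pd Pr hr h),
    one_sub_screen_mul v Pd Pr hr, screen_def, mul_assoc, Ring.mul_inverse_cancel_left _ _ h]

end Screening

/-! ### The finite-basis (matrix) form -/

section MatrixScreening

variable {K : Type*} [CommRing K] {n : Type*} [Fintype n] [DecidableEq n]

/-- [cite: AryasetiawanEtAl2004, §II] For square matrices `screen v P = (1 - v P)⁻¹ v` with
Mathlib's nonsingular inverse (which agrees with `Ring.inverse` on matrices). -/
theorem matrix_screen_eq_nonsing_inv_mul (v P : Matrix n n K) :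
    screen v P = (1 - v * P)⁻¹ * v := by
  rw [screen_def, Matrix.nonsing_inv_eq_ringInverse]

/-- **cRPA screening composition, matrix form** [cite: AryasetiawanEtAl2004, §II];
[cite: WernerEtAl2015, §II.B Eq. (1)]: for `n × n` matrices `v, P_d, P_r` over a commutative
ring with `det (1 - vP_r)` and `det (1 - v(P_d + P_r))` units, writing `W_r = (1 - vP_r)⁻¹ v`,
the matrix `1 - W_r P_d` has unit determinant and `(1 - W_r P_d)⁻¹ W_r = (1 - v(P_d + P_r))⁻¹ v`. -/
theorem matrix_screen_screen (v Pd Pr : Matrix n n K) (hr : IsUnit (1 - v * Pr).det)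
    (h : IsUnit (1 - v * (Pd + Pr)).det) :
    IsUnit (1 - (1 - v * Pr)⁻¹ * v * Pd).det ∧
      (1 - (1 - v * Pr)⁻¹ * v * Pd)⁻¹ * ((1 - v * Pr)⁻¹ * v) = (1 - v * (Pd + Pr))⁻¹ * v := by
  have hr' : IsUnit (1 - v * Pr) := (Matrix.isUnit_iff_isUnit_det _).mpr hr
  have h' : IsUnit (1 - v * (Pd + Pr)) := (Matrix.isUnit_iff_isUnit_det _).mpr h
  have hW : (1 - v * Pr)⁻¹ * v = screen v Pr := (matrix_screen_eq_nonsing_inv_mul v Pr).symm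
  refine ⟨?_, ?_⟩
  · rw [hW, ← Matrix.isUnit_iff_isUnit_det]
    exact isUnit_one_sub_screen_mul v Pd Pr hr' h'
  · rw [hW, ← matrix_screen_eq_nonsing_inv_mul, ← matrix_screen_eq_nonsing_inv_mul]
    exact screen_screen v Pd Pr hr' h'

end MatrixScreening

/-! ## 2. Löwdin partitioning of a block eigenproblem -/

section Loewdin

open Matrix

/-- Scalar multiplication distributes over `Sum.elim` of coordinate vectors. [folklore] -/
private theorem smul_sumElim {K : Type*} [Mul K] {m n : Type*} (ω : K) (x : m → K)
    (y : n → K) : ω • Sum.elim x y = Sum.elim (ω • x) (ω • y) := by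
  ext i
  cases i <;> rfl

variable {K : Type*} [CommRing K] {m n : Type*} [Fintype n] [DecidableEq n]

/-- Löwdin's energy-dependent downfolded (effective) Hamiltonian on the retained block of
`fromBlocks A B C D` at energy `ω`: `H_eff(ω) = A + B (ω - D)⁻¹ C` (nonsingular inverse; the
theorems assume `IsUnit (ω•1 - D).det`) — the P-space block of the Bloch–Horowitz / Feshbach /
Löwdin effective Hamiltonian `𝓗(E) = H + H (E - QHQ)⁻¹ H` with `A = PHP`, `B = PHQ`, `C = QHP`,
`D = QHQ`. [cite: BognerKuoSchwenk2003, §2.1 Eq. (24)] -/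
noncomputable def loewdinHam (A : Matrix m m K) (B : Matrix m n K) (C : Matrix n m K)
    (D : Matrix n n K) (ω : K) : Matrix m m K :=
  A + B * (ω • (1 : Matrix n n K) - D)⁻¹ * C

/-- [cite: BognerKuoSchwenk2003, §2.1 Eq. (24)] Unfolding lemma for `loewdinHam`. -/
theorem loewdinHam_def (A : Matrix m m K) (B : Matrix m n K) (C : Matrix n m K)
    (D : Matrix n n K) (ω : K) :
    loewdinHam A B C D ω = A + B * (ω • (1 : Matrix n n K) - D)⁻¹ * C := rfl

/-- [cite: BognerKuoSchwenk2003, §2.1 Eq. (24)] With no coupling to the eliminated block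
(`B = PHQ = 0`) the effective Hamiltonian is the bare P-block `A`. -/
theorem loewdinHam_zero_left (A : Matrix m m K) (C : Matrix n m K) (D : Matrix n n K) (ω : K) :
    loewdinHam A 0 C D ω = A := by
  simp [loewdinHam]

/-- [cite: BognerKuoSchwenk2003, §2.1 Eq. (24)] Schur-complement form of the same operator:
`H_eff(ω) - ω•1 = (A - ω•1) - B (D - ω•1)⁻¹ C`, i.e. `H_eff(ω) - ω•1` is the Schur complement of
the block `D - ω•1` in `fromBlocks A B C D - ω•1` (for `ω` off the spectrum of `D`; this is the form
behind "the determinant of a block-triangular matrix factorizes", loc. cit. after Eq. (28)). -/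
theorem loewdinHam_sub_smul_one [DecidableEq m] (A : Matrix m m K) (B : Matrix m n K)
    (C : Matrix n m K) (D : Matrix n n K) (ω : K) (hD : IsUnit (ω • (1 : Matrix n n K) - D).det) :
    loewdinHam A B C D ω - ω • (1 : Matrix m m K) =
      (A - ω • (1 : Matrix m m K)) - B * (D - ω • (1 : Matrix n n K))⁻¹ * C := by
  have hneg : D - ω • (1 : Matrix n n K) = -(ω • (1 : Matrix n n K) - D) := (neg_sub _ _).symm
  have hinv : (D - ω • (1 : Matrix n n K))⁻¹ = -(ω • (1 : Matrix n n K) - D)⁻¹ := by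
    rw [hneg]
    exact Matrix.inv_eq_left_inv (by rw [neg_mul_neg, Matrix.nonsing_inv_mul _ hD])
  rw [hinv, loewdinHam, Matrix.mul_neg, Matrix.neg_mul, sub_neg_eq_add]
  abel

/-- **Löwdin / Bloch–Horowitz partitioning** [cite: BognerKuoSchwenk2003, §2.1 Eqs. (22)–(24)]
(there: the block Schrödinger equation (22), "by using the second block row … the Q-space
projection can be eliminated and one obtains" (23) with (24), and "the Q-space states have been
decoupled … in a way that preserves the low-energy spectrum exactly"; originally Löwdin 1951,
Feshbach 1958, Bloch–Horowitz 1958): if `ω•1 - D` is invertible, then `x ⊕ y` satisfies the block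
eigen-equation `H (x ⊕ y) = ω (x ⊕ y)` for `H = fromBlocks A B C D` (the zero vector allowed) if and
only if the eliminated amplitudes are slaved, `y = (ω - D)⁻¹ C x`, and the retained amplitudes
solve the DOWNFOLDED eigen-equation `H_eff(ω) x = ω x`. -/
theorem fromBlocks_mulVec_eq_smul_iff [Fintype m] (A : Matrix m m K) (B : Matrix m n K)
    (C : Matrix n m K) (D : Matrix n n K) (ω : K) (hD : IsUnit (ω • (1 : Matrix n n K) - D).det)
    (x : m → K) (y : n → K) :
    fromBlocks A B C D *ᵥ Sum.elim x y = ω • Sum.elim x y ↔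
      y = ((ω • (1 : Matrix n n K) - D)⁻¹ * C) *ᵥ x ∧ loewdinHam A B C D ω *ᵥ x = ω • x := by
  have hM1 : (ω • (1 : Matrix n n K) - D) *ᵥ y = ω • y - D *ᵥ y := by
    rw [sub_mulVec, smul_mulVec, one_mulVec]
  -- the bottom block equation `C x + D y = ω y` says `(ω - D) y = C x`
  have bottom : C *ᵥ x + D *ᵥ y = ω • y ↔ y = ((ω • (1 : Matrix n n K) - D)⁻¹ * C) *ᵥ x := by
    constructor
    · intro hy
      have hMy : (ω • (1 : Matrix n n K) - D) *ᵥ y = C *ᵥ x := by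
        rw [hM1, ← hy, add_sub_cancel_right]
      rw [← mulVec_mulVec, ← hMy, mulVec_mulVec, Matrix.nonsing_inv_mul _ hD, one_mulVec]
    · intro hy
      have hMy : (ω • (1 : Matrix n n K) - D) *ᵥ y = C *ᵥ x := by
        rw [hy, mulVec_mulVec, Matrix.mul_nonsing_inv_cancel_left _ _ hD]
      rw [← hMy, hM1, sub_add_cancel]
  rw [smul_sumElim, fromBlocks_mulVec, Sum.elim_comp_inl, Sum.elim_comp_inr, Sum.elim_eq_iff,
    bottom]
  constructor
  · rintro ⟨htop, hy⟩
    refine ⟨hy, ?_⟩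
    rw [loewdinHam, add_mulVec, Matrix.mul_assoc, ← mulVec_mulVec, ← hy]
    exact htop
  · rintro ⟨hy, heff⟩
    refine ⟨?_, hy⟩
    rw [hy, mulVec_mulVec, ← Matrix.mul_assoc, ← add_mulVec]
    exact heff

/-- [cite: BognerKuoSchwenk2003, §2.1 Eq. (23)] Forward direction as a named corollary ("the
eigenstates of `H^BH(E)` are simply given by the P-space projections of the exact eigenstates"):
every solution of the full block eigen-equation at an energy `ω` off the spectrum of `D` solves the
downfolded one. -/
theorem loewdinHam_mulVec_of_eigen [Fintype m] (A : Matrix m m K) (B : Matrix m n K)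
    (C : Matrix n m K) (D : Matrix n n K) (ω : K) (hD : IsUnit (ω • (1 : Matrix n n K) - D).det)
    (x : m → K) (y : n → K) (h : fromBlocks A B C D *ᵥ Sum.elim x y = ω • Sum.elim x y) :
    loewdinHam A B C D ω *ᵥ x = ω • x :=
  ((fromBlocks_mulVec_eq_smul_iff A B C D ω hD x y).mp h).2

/-- [cite: BognerKuoSchwenk2003, §2.1 Eqs. (22)–(23)] Backward direction (upfolding; "preserves
the low-energy spectrum exactly"): a solution `x` of the downfolded equation at `ω` lifts to the
full eigenvector `x ⊕ (ω - D)⁻¹ C x`. -/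
theorem eigen_of_loewdinHam_mulVec [Fintype m] (A : Matrix m m K) (B : Matrix m n K)
    (C : Matrix n m K) (D : Matrix n n K) (ω : K) (hD : IsUnit (ω • (1 : Matrix n n K) - D).det)
    (x : m → K) (h : loewdinHam A B C D ω *ᵥ x = ω • x) :
    fromBlocks A B C D *ᵥ Sum.elim x (((ω • (1 : Matrix n n K) - D)⁻¹ * C) *ᵥ x) =
      ω • Sum.elim x (((ω • (1 : Matrix n n K) - D)⁻¹ * C) *ᵥ x) :=
  (fromBlocks_mulVec_eq_smul_iff A B C D ω hD x _).mpr ⟨rfl, h⟩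

end Loewdin

/-! ## 3. The scalar (single-band) screening map: inversion, saturation, sensitivity
(model-mapped RPA, Sakakibara–Jang–Kino–Han–Kuroki–Kotani 2017)

For a single-band model the polarization `P_M ≤ 0` and the interactions are scalars, and the
RPA-screened on-site interaction of the MODEL is `W_M(U_M) = (1 − U_M P_M)⁻¹ U_M`
[SakakibaraEtAl2016, Eq. (8)].  "Model-mapped RPA" fixes `U_M` by the matching condition
`W_M(U_M) = W_FP` (the first-principles fully screened on-site value) [SakakibaraEtAl2016, Eq. (9)].
The printed observations — `W_M` is increasing in `U_M`, «initially linear near `U_M = 0` and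
saturate[s] toward `−1/P_M`», and `U_M` is SENSITIVE to `W_FP` when `dW/dU = (1 − U P)⁻²` is small
(p. 4–5: `0.060` for LDA, `0.019` for QSGW in HgBa₂CuO₄) — are the following exact statements
about the map `U ↦ U/(1 − U P)`; the inversion `U_M = W_FP/(1 + P_M W_FP)` is its closed form. -/

section ScalarScreening

/-- The scalar screening map is the file's `screen` read in a field: `screen U P = U / (1 − U·P)`.
[cite: SakakibaraEtAl2016, Eq. (8)] -/
theorem screen_real_eq (U P : ℝ) : screen U P = U / (1 - U * P) := by
  rw [screen_def, Ring.inverse_eq_inv', div_eq_inv_mul]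

/-- **mRPA inversion**: if `W = U/(1 − U P)` with `1 − U P ≠ 0`, then `1 + P W ≠ 0` and
`U = W/(1 + P W)` — the closed form of the matching condition `W_M(U_M) = W_FP`.
[cite: SakakibaraEtAl2016, Eq. (9)] -/
theorem mRPA_inversion {U P W : ℝ} (h : 1 - U * P ≠ 0) (hW : W = U / (1 - U * P)) :
    1 + P * W ≠ 0 ∧ U = W / (1 + P * W) := by
  have h' : 1 - P * U ≠ 0 := by rwa [mul_comm] at h
  have h1 : 1 + P * W = 1 / (1 - U * P) := by
    rw [hW, eq_div_iff h]
    field_simp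
    ring
  have hne : 1 + P * W ≠ 0 := by rw [h1]; exact div_ne_zero one_ne_zero h
  refine ⟨hne, ?_⟩
  rw [h1, hW]
  field_simp

/-- Conversely `U = W/(1 + P W)` solves the matching condition: `U/(1 − U P) = W`.
[cite: SakakibaraEtAl2016, Eq. (9)] -/
theorem mRPA_matching {P W : ℝ} (h : 1 + P * W ≠ 0) :
    (W / (1 + P * W)) / (1 - W / (1 + P * W) * P) = W := by
  have h' : 1 + W * P ≠ 0 := by rwa [mul_comm] at h
  have h2 : 1 - W / (1 + P * W) * P = 1 / (1 + P * W) := by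
    rw [eq_div_iff h]
    field_simp
    ring
  rw [h2, div_div_eq_mul_div, div_one, div_mul_cancel₀ _ h]

/-- **Saturation**: for `P < 0` and `U ≥ 0` the screened value stays below `−1/P`
(«saturate toward −1/P_M»). [cite: SakakibaraEtAl2016, §IV p. 4] -/
theorem screen_lt_neg_inv {U P : ℝ} (hP : P < 0) (hU : 0 ≤ U) : U / (1 - U * P) < -1 / P := by
  have hden : 0 < 1 - U * P := by nlinarith
  have hP' : 0 < -P := neg_pos.mpr hP
  rw [show (-1 : ℝ) / P = 1 / (-P) by rw [div_neg, neg_div], div_lt_div_iff₀ hden hP']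
  nlinarith

/-- **Monotonicity**: the scalar screening map is strictly increasing in `U` on the region
`1 − U P > 0` (in particular on `U ≥ 0` when `P ≤ 0`). [cite: SakakibaraEtAl2016, Fig. 1] -/
theorem screen_strictMono {U₁ U₂ P : ℝ} (hP : P ≤ 0) (h₁ : 0 ≤ U₁) (h12 : U₁ < U₂) :
    U₁ / (1 - U₁ * P) < U₂ / (1 - U₂ * P) := by
  have hd1 : 0 < 1 - U₁ * P := by nlinarith
  have hd2 : 0 < 1 - U₂ * P := by nlinarith
  rw [div_lt_div_iff₀ hd1 hd2]
  nlinarith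

/-- **Sensitivity**: `d/dU [U/(1 − U P)] = (1 − U P)⁻²`, so the matched `U_M` responds to the
first-principles input as `dU_M/dW_FP = (1 − U_M P_M)²` — large when `W_M` is near saturation
(printed `dW/dU = 0.060` (LDA), `0.019` (QSGW) for HgBa₂CuO₄). [cite: SakakibaraEtAl2016, §IV p. 4–5] -/
theorem hasDerivAt_screen (P : ℝ) {U : ℝ} (h : 1 - U * P ≠ 0) :
    HasDerivAt (fun u : ℝ => u / (1 - u * P)) (1 / (1 - U * P) ^ 2) U := by
  have hnum : HasDerivAt (fun u : ℝ => u) 1 U := hasDerivAt_id U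
  have hden : HasDerivAt (fun u : ℝ => 1 - u * P) (-P) U := by
    simpa using ((hasDerivAt_id U).mul_const P).const_sub 1
  have hd := hnum.div hden h
  refine hd.congr_deriv ?_
  have h' : 1 - P * U ≠ 0 := by rwa [mul_comm] at h
  field_simp
  ring

end ScalarScreening

/-! ## 4. The resolvent form of Löwdin partitioning: the target block of the Green's function
(Profe–Vučičević–Stavropoulos–Rösner–Valentí–Klebl 2025, §III A)

Appended 2026-08-30 (cell hubbard-downfold, seat lit-2).  §2 states Löwdin exactness at the level
of eigenvectors.  The same algebra at the level of the RESOLVENT is the statement behind every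
"integrate out the rest space" construction of a one-particle effective model: for a block
one-body matrix `H = fromBlocks A B C D` (target block `A`, rest block `D`, couplings `B`, `C`) and a
complex energy `z` off the spectrum of `D`, the TARGET BLOCK of the full resolvent `(z − H)⁻¹`
equals the resolvent of the energy-dependent downfolded Hamiltonian,
`[(z − H)⁻¹]_{target} = (z − H_eff(z))⁻¹`, `H_eff(z) = A + B (z − D)⁻¹ C = loewdinHam A B C D z`.
In the exact-downfolding formalism of Profe et al. this is the case of a non-interacting rest space
kinetically coupled to the target space [ProfeEtAl2025ExactDownfolding, §III A Eqs. (21)–(25)]: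
integrating out the rest fields produces the "retarded hopping (retarded hybridization)"
`A^{1:1} g^{(1)} Ã^{1:1}` (Eq. (24); `g^{(1)} = (iω − μ − T^c)⁻¹`), the exact target-space action
is quadratic with kernel `T̃^f + A^{1:1} g^{(1)} Ã^{1:1}` (Eq. (25)), and «this term is sufficient
to ensure that the spectral function calculated from the effective target-space model is
identical to the spectral function obtained by the corresponding calculation in the full model»
(loc. cit., after Eq. (25); used for the `d_{x²−y²}` target of the infinite-layer cuprate SrCuO₂ in
§IV B: «this hybridization then ensures that the projected spectral function of the full model is
exactly recovered (by construction)»).  With `z = iω + μ`, `A = T^f`, `D = T^c`, `B`/`C` the two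
kinetic couplings, the three theorems below are exactly that statement for finite matrices over a
commutative ring (so in particular over `ℂ` at every Matsubara or retarded frequency):

* `smul_one_sub_fromBlocks` — `z•1 − H = fromBlocks (z•1 − A) (−B) (−C) (z•1 − D)` [folklore];
* `det_smul_one_sub_fromBlocks` — `det (z − H) = det (z − D) · det (z − H_eff(z))` (the spectrum of
  `H` off `spec D` is where `z − H_eff(z)` is singular: `det_smul_one_sub_fromBlocks_eq_zero_iff`);
* `inv_smul_one_sub_fromBlocks_toBlocks₁₁` — **the target block of the resolvent is the resolvent
  of the downfolded Hamiltonian**, `((z•1 − H)⁻¹).toBlocks₁₁ = (z•1 − H_eff(z))⁻¹`, under the two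
  invertibility hypotheses (`z` off `spec D` and off `spec H`).

All three are Mathlib's Schur-complement algebra (`Matrix.det_fromBlocks₂₂`,
`Matrix.invOf_fromBlocks₂₂_eq`) read through `loewdinHam`; nothing approximate enters.  NOT here:
the interacting rest space (Profe et al. §III B ff.: the `A^{2:2}`, `A^{1:3}`, `B^{2:2}` vertex
corrections and the `Tr log M` term are genuinely many-body and are not matrix identities), and the
frequency-independent "Wannier Hamiltonian" reading of `H_eff(z)` (an approximation, as §2 notes). -/

section Resolvent

open Matrix

variable {K : Type*} [CommRing K] {m n : Type*} [Fintype m] [Fintype n] [DecidableEq m]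
  [DecidableEq n]

omit [Fintype m] [Fintype n] in
/-- `z•1 − fromBlocks A B C D = fromBlocks (z•1 − A) (−B) (−C) (z•1 − D)`: the block form of the
inverse propagator of the full quadratic model, target and rest actions `S[f]`, `S[c]` on the
diagonal and the two kinetic couplings off it. [cite: ProfeEtAl2025ExactDownfolding, §III A Eqs. (21)–(23)] -/
theorem smul_one_sub_fromBlocks (A : Matrix m m K) (B : Matrix m n K) (C : Matrix n m K)
    (D : Matrix n n K) (z : K) :
    z • (1 : Matrix (m ⊕ n) (m ⊕ n) K) - fromBlocks A B C D =
      fromBlocks (z • (1 : Matrix m m K) - A) (-B) (-C) (z • (1 : Matrix n n K) - D) := by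
  rw [← fromBlocks_one, fromBlocks_smul, sub_eq_add_neg, fromBlocks_neg, fromBlocks_add]
  simp [sub_eq_add_neg]

omit [Fintype m] in
/-- The Schur complement of the rest block of `z•1 − H` is `z•1 − H_eff(z)`:
`(z•1 − A) − (−B) (z•1 − D)⁻¹ (−C) = z•1 − loewdinHam A B C D z`.
[cite: ProfeEtAl2025ExactDownfolding, §III A Eq. (25)] -/
theorem schur_smul_one_sub_eq (A : Matrix m m K) (B : Matrix m n K) (C : Matrix n m K)
    (D : Matrix n n K) (z : K) :
    (z • (1 : Matrix m m K) - A) - (-B) * (z • (1 : Matrix n n K) - D)⁻¹ * (-C) =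
      z • (1 : Matrix m m K) - loewdinHam A B C D z := by
  rw [loewdinHam, Matrix.neg_mul, Matrix.neg_mul, Matrix.mul_neg, neg_neg]
  abel

/-- **Determinant factorisation** `det (z − H) = det (z − D) · det (z − H_eff(z))` for
`H = fromBlocks A B C D` and `z` off the spectrum of the rest block `D`: the characteristic
function of the full one-body problem factors through the energy-dependent downfolded one.
[cite: ProfeEtAl2025ExactDownfolding, §III A Eqs. (24)–(25)] (the Gaussian rest-space integral;
cf. [BognerKuoSchwenk2003, §2.1 after Eq. (28)]). -/
theorem det_smul_one_sub_fromBlocks (A : Matrix m m K) (B : Matrix m n K) (C : Matrix n m K)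
    (D : Matrix n n K) (z : K) (hD : IsUnit (z • (1 : Matrix n n K) - D).det) :
    (z • (1 : Matrix (m ⊕ n) (m ⊕ n) K) - fromBlocks A B C D).det =
      (z • (1 : Matrix n n K) - D).det * (z • (1 : Matrix m m K) - loewdinHam A B C D z).det := by
  letI : Invertible (z • (1 : Matrix n n K) - D) := invertibleOfIsUnitDet _ hD
  rw [smul_one_sub_fromBlocks, det_fromBlocks₂₂, invOf_eq_nonsing_inv, schur_smul_one_sub_eq]

/-- Corollary: off the spectrum of the rest block, `z − H` is singular exactly when
`z − H_eff(z)` is — the energies of the full model in the window where `z − D` is invertible are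
the self-consistent solutions of the downfolded problem.
[cite: ProfeEtAl2025ExactDownfolding, §III A (after Eq. (25))] -/
theorem det_smul_one_sub_fromBlocks_eq_zero_iff (A : Matrix m m K) (B : Matrix m n K)
    (C : Matrix n m K) (D : Matrix n n K) (z : K) (hD : IsUnit (z • (1 : Matrix n n K) - D).det) :
    (z • (1 : Matrix (m ⊕ n) (m ⊕ n) K) - fromBlocks A B C D).det = 0 ↔
      (z • (1 : Matrix m m K) - loewdinHam A B C D z).det = 0 := by
  rw [det_smul_one_sub_fromBlocks A B C D z hD]
  exact hD.mul_right_eq_zero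

/-- Corollary: off the spectrum of the rest block, `z − H` is invertible exactly when
`z − H_eff(z)` is. [cite: ProfeEtAl2025ExactDownfolding, §III A (after Eq. (25))] -/
theorem isUnit_det_smul_one_sub_fromBlocks_iff (A : Matrix m m K) (B : Matrix m n K)
    (C : Matrix n m K) (D : Matrix n n K) (z : K) (hD : IsUnit (z • (1 : Matrix n n K) - D).det) :
    IsUnit (z • (1 : Matrix (m ⊕ n) (m ⊕ n) K) - fromBlocks A B C D).det ↔
      IsUnit (z • (1 : Matrix m m K) - loewdinHam A B C D z).det := by
  rw [det_smul_one_sub_fromBlocks A B C D z hD, IsUnit.mul_iff, and_iff_right hD]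

/-- **The target block of the resolvent is the resolvent of the downfolded Hamiltonian**:
for `H = fromBlocks A B C D` and `z` such that both `z•1 − D` and `z•1 − H_eff(z)` are invertible,
`((z•1 − H)⁻¹).toBlocks₁₁ = (z•1 − loewdinHam A B C D z)⁻¹`.  Read with `z = iω + μ`, target
one-body matrix `A = T^f`, rest `D = T^c` and kinetic couplings `B`, `C`: the target-space Green's
function of the full quadratic model IS the Green's function of the model with the retarded
hybridization `B (z − D)⁻¹ C` added — «sufficient to ensure that the spectral function calculated
from the effective target-space model is identical to the spectral function obtained by the
corresponding calculation in the full model». [cite: ProfeEtAl2025ExactDownfolding, §III A Eqs. (24)–(25)] -/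
theorem inv_smul_one_sub_fromBlocks_toBlocks₁₁ (A : Matrix m m K) (B : Matrix m n K)
    (C : Matrix n m K) (D : Matrix n n K) (z : K) (hD : IsUnit (z • (1 : Matrix n n K) - D).det)
    (hS : IsUnit (z • (1 : Matrix m m K) - loewdinHam A B C D z).det) :
    ((z • (1 : Matrix (m ⊕ n) (m ⊕ n) K) - fromBlocks A B C D)⁻¹).toBlocks₁₁ =
      (z • (1 : Matrix m m K) - loewdinHam A B C D z)⁻¹ := by
  letI iD : Invertible (z • (1 : Matrix n n K) - D) := invertibleOfIsUnitDet _ hD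
  have hSe : (z • (1 : Matrix m m K) - A) - (-B) * ⅟(z • (1 : Matrix n n K) - D) * (-C) =
      z • (1 : Matrix m m K) - loewdinHam A B C D z := by
    rw [invOf_eq_nonsing_inv, schur_smul_one_sub_eq]
  letI iS : Invertible ((z • (1 : Matrix m m K) - A) - (-B) * ⅟(z • (1 : Matrix n n K) - D) * (-C)) :=
    (invertibleOfIsUnitDet _ hS).copy _ hSe
  letI iH : Invertible (fromBlocks (z • (1 : Matrix m m K) - A) (-B) (-C)
      (z • (1 : Matrix n n K) - D)) := fromBlocks₂₂Invertible _ _ _ _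
  rw [smul_one_sub_fromBlocks, ← invOf_eq_nonsing_inv, invOf_fromBlocks₂₂_eq, toBlocks_fromBlocks₁₁,
    invOf_eq_nonsing_inv, hSe]

/-- The uncoupled check: with no kinetic coupling to the rest space (`B = 0`) the target block of
the resolvent is the bare target resolvent `(z•1 − A)⁻¹` (Profe et al.: «In the absence of
entanglement we have `A^{1:1} = 0`»). [cite: ProfeEtAl2025ExactDownfolding, §III A (after Eq. (23))] -/
theorem inv_smul_one_sub_fromBlocks_toBlocks₁₁_of_zero (A : Matrix m m K) (C : Matrix n m K)
    (D : Matrix n n K) (z : K) (hD : IsUnit (z • (1 : Matrix n n K) - D).det)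
    (hA : IsUnit (z • (1 : Matrix m m K) - A).det) :
    ((z • (1 : Matrix (m ⊕ n) (m ⊕ n) K) - fromBlocks A 0 C D)⁻¹).toBlocks₁₁ =
      (z • (1 : Matrix m m K) - A)⁻¹ := by
  have h := inv_smul_one_sub_fromBlocks_toBlocks₁₁ A 0 C D z hD (by rwa [loewdinHam_zero_left])
  rwa [loewdinHam_zero_left] at h

end Resolvent

end Literature.MathematicalPhysics.QuantumLattice
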